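import Summits.ResolutionOfSingularities.ResolutionOfSingularities.Theorems.MarkedTransferCampaignW46MohWindowSurfaceHeavyRoot
import Literature.AlgebraicGeometry.Resolution.WeightedInitialTerms
import HarnessLib

/-!
# [OURS · L1 W4.6 rung (iii-2), EVERY `p`] Surface Moh window — THE STALLING THREAD WITH COORDINATES: at each non-dropping hit the thread
# child is the point of the exceptional line over a `κ`-rational HEAVY ROOT of the centre (cell res-hironaka, LADDER-RESOLUTION rung L,
# D-0089; seat res-L1-s46-pv-5 gen 5; host MarkedTransfer, `--supports stmt-ResolutionOfSingularities-16155 --as helper`; statement file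
# `…CampaignW46MohWindowSurface.lean`)

HONEST FRAMING. Nothing here is a statement of H. Hironaka's manuscript [Hironaka2017] and nothing here asserts that any
statement of it holds. THEOREMS about the OURS regime `CampaignW46.Regime.mohWindowSurface` (o1 §5; every `p`, every `K`), packaging
`…StallThread.lean` (a branch of singular points hit infinitely often without drop of the residual order), the chart family of the blow-up
at the hit (`IsBlowup.exists_chartFamily`, res-L1-s46-pv-3) and `…HeavyRoot.lean` (`heavyRoot_of_le_exponent`): at every such hit `k` and
for EVERY coefficient window presentation `c = (x, y, z)`, `J_{b_k} = (z^p + Σ a_i x^{d−i} y^i)`, the thread child `b_{k+1}` is presented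
through the Rees chart `j ∈ {x, y}` at a prime containing `c_j`, `z/c_j` and `α·(c_{j′}/c_j) + β` where `(ᾱ X + β̄)^p` divides the chart's
residue polynomial — the centre `b_k` is HEAVY with `κ`-rational heavy root `λ̄ = −β̄/ᾱ` and `b_{k+1}` is THE point of the exceptional line
over `λ̄` (`…ChartLine.lean`). This is the scheme-level form, with coordinates, of an infinite «kangaroo» thread — what the non-tame rung for
`p ≥ 3` must exclude. AI-written; AI review is weaker than expert review. No `sorry`; axioms standard.
[ZariskiSamuel1960] [Matsumura1987] [HauserWagner2014] [CossartPiltant2008]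
-/

noncomputable section

set_option linter.dupNamespace false -- mandated namespace of this single-conjunct summit

open CategoryTheory AlgebraicGeometry TopologicalSpace IsLocalRing

namespace Summit.ResolutionOfSingularities.ResolutionOfSingularities.Theorems

namespace CampaignW46

open Literature.AlgebraicGeometry.Resolution
open Literature.AlgebraicGeometry.Hironaka2017.S02Preliminaries
open Literature.AlgebraicGeometry.Hironaka2017.Datum
open Literature.AlgebraicGeometry.Hironaka2017.S16Proof
open Scheme.IdealSheafData
open Polynomial

universe u

variable {p : ℕ} [Fact p.Prime] {K : Type u} [Field K] [CharP K p]
variable {A A' : AmbientDatum p K} {E : IdealExponent A.Z}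

set_option maxHeartbeats 800000 in
-- chart-family bookkeeping over `CommRingCat.of` stalks (as in the tree's `IsBlowup.exists_chart_morphism`)
/-- **[OURS · L1 W4.6 rung (iii-2), every `p`] A NON-DROPPING SINGULAR POINT OVER AN ADMITTED CENTRE, IN COORDINATES.** Let `π` be a
§2.1-permissible blow-up of a state of `Regime.mohWindowSurface` with transform again in the regime, `x′ ∈ Sing(E′)` over the centre point `s`
with `residualOrder(J′_{x′}) ≥ residualOrder(J_s)`. Then for EVERY coefficient window presentation `c = (c₀, c₁, c₂)` of `𝔪_s`,
`J_s = (c₂^p + Σ a_k c₀^{d−k} c₁^k)`, there are a Rees chart `j ≠ 2`, a chart morphism `q : Spec B_j → Z′` over `Spec B_j → Spec 𝒪_{Z,s} → Z`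
computing the local ring at a prime `w` with `q w = x′`, and `α, β ∈ 𝒪_{Z,s}`, `α` a unit, such that `(ᾱ X + β̄)^p` divides the chart-`j`
residue polynomial and `c_j, c₂/c_j, α·(c_{j′}/c_j) + β ∈ w`. NOT a statement of the manuscript. [folklore] -/
theorem exists_chart_heavyRoot_of_le_residualOrder {D : Closeds A.Z} (π : A'.Z ⟶ A.Z) (hπ : IsBlowup π (vanishingIdeal D))
    (hD : E.IsPermissibleCentre A.hom D) (hRg : Regime.mohWindowSurface A E)
    (hRg' : Regime.mohWindowSurface A' (E.transform π D)) {x' : A'.Z} (hx' : x' ∈ (E.transform π D).sing) {s : A.Z}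
    (hs : π.base x' = s) (hsD : s ∈ (D : Set A.Z))
    (hle : (residualOrder E.b (A.Z.presheaf.stalk s) (stalkIdeal E.J s)).toNat ≤
      (residualOrder (E.transform π D).b (A'.Z.presheaf.stalk x') (stalkIdeal (E.transform π D).J x')).toNat)
    (c : Fin 3 → A.Z.presheaf.stalk s) (hc : Ideal.span (Set.range c) = maximalIdeal _) {d : ℕ} (hpd : p < d)
    (hd2 : d < 2 * p) (a : ℕ → A.Z.presheaf.stalk s) (hunit : ∃ k ≤ d, IsUnit (a k))
    (hJ : stalkIdeal E.J s = Ideal.span {c 2 ^ p + ∑ k ∈ Finset.range (d + 1), a k * c 0 ^ (d - k) * c 1 ^ k}) :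
    ∃ (j : Fin 3) (q : Spec (.of (chartRing c j)) ⟶ A'.Z) (w : Spec (.of (chartRing c j))),
      j ≠ 2 ∧ q w = x' ∧ IsIso (q.stalkMap w) ∧
      q ≫ π = Spec.map (CommRingCat.ofHom (chartBase c j)) ≫ A.Z.fromSpecStalk s ∧
      chartBase c j (c j) ∈ w.asIdeal ∧ chartGen c j 2 ∈ w.asIdeal ∧
      ∃ α β : A.Z.presheaf.stalk s, IsUnit α ∧
        (C (residue _ α) * X + C (residue _ β)) ^ p ∣
          ∑ k ∈ Finset.range (d + 1), C (residue _ (a k)) *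
            X ^ ((![fun k => min k d, fun k => d - k, fun _ => 0] : Fin 3 → ℕ → ℕ) j k) ∧
        chartBase c j α * chartGen c j ((![1, 0, 0] : Fin 3 → Fin 3) j) + chartBase c j β ∈ w.asIdeal := by
  classical
  obtain ⟨ξ, hξS, hξcl, hDξ⟩ := IsPermissibleCentre.exists_eq_singleton_of_isolatedSing hD ⟨hRg.2.1, hRg.2.2.1⟩
  have hsξ : s = ξ := by simpa [hDξ] using hsD
  subst hsξ
  obtain ⟨hb, -, -, hwin⟩ := hRg
  obtain ⟨-, -, -, hwin'⟩ := hRg'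
  have hbE' : (E.transform π D).b = E.b := rfl
  haveI : IsLocallyNoetherian A'.Z := by
    haveI := A'.smooth
    exact LocallyOfFiniteType.isLocallyNoetherian A'.hom
  -- regularity downstairs, the presentation upstairs
  obtain ⟨hRreg, h3, -⟩ := hwin _ hξS
  haveI := hRreg
  obtain ⟨hLreg, h3L, x₁, y₁, z₁, hxyz₁, d₁, a₁, hbd₁, hd2₁, hunit₁, hJ₁⟩ := hwin' _ hx'
  rw [hbE', hb] at hbd₁ hd2₁ hJ₁
  haveI := hLreg
  haveI : CharP (A.Z.presheaf.stalk s) p := Lem16p11Proof.charP_stalk A (𝟙 A.Z) s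
  haveI : CharP (A'.Z.presheaf.stalk x') p := Lem16p11Proof.charP_stalk A π x'
  have hxyz : Ideal.span {c 0, c 1, c 2} = maximalIdeal (A.Z.presheaf.stalk s) := by
    rw [← hc, range_fin_three]
  -- the non-drop in exponent form
  have hdd : d ≤ d₁ := by
    have h := hle
    rw [hbE', hb, hJ, hJ₁, MohWindowSurface.residualOrder_coeff p hLreg h3L hxyz₁ hbd₁ hd2₁ hunit₁,
      MohWindowSurface.residualOrder_coeff p hRreg h3 hxyz hpd hd2 hunit, ENat.toNat_coe, ENat.toNat_coe] at h
    exact h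
  -- the chart family at the centre point
  have hY : stalkIdeal (vanishingIdeal D) s = maximalIdeal (A.Z.presheaf.stalk s) := by
    apply stalkIdeal_vanishingIdeal_eq_maximalIdeal_of_closure_eq
    rw [hDξ, hξcl.closure_eq]
  have hcY : Ideal.span (Set.range c) = stalkIdeal (vanishingIdeal D) s := hc.trans hY.symm
  obtain ⟨q, hq, hpts⟩ := hπ.exists_chartFamily s c hcY
  obtain ⟨j, w, hqw, hiso⟩ := hpts x' hs
  have hx'b : (p : ℕ∞) ≤ idealOrder (controlledTransform π (vanishingIdeal D) E.J p) x' := by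
    have := hx'
    simp only [IdealExponent.sing, IdealExponent.transform, Set.mem_setOf_eq, hb] at this
    exact_mod_cast this
  have hJt : stalkIdeal (controlledTransform π (vanishingIdeal D) E.J p) x' = stalkIdeal (E.transform π D).J x' := by
    show stalkIdeal (controlledTransform π (vanishingIdeal D) E.J p) x' =
      stalkIdeal (controlledTransform π (vanishingIdeal D) E.J E.b) x'
    rw [hb]
  have hJ₁' : stalkIdeal (controlledTransform π (vanishingIdeal D) E.J p) x' =
      Ideal.span {z₁ ^ p + ∑ k ∈ Finset.range (d₁ + 1), a₁ k * x₁ ^ (d₁ - k) * y₁ ^ k} := hJt.trans hJ₁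
  haveI := hiso
  obtain ⟨hj2, hcj, h2, α, β, hα, hdvd, hmem⟩ := MohWindowSurface.heavyRoot_of_le_exponent (π := π) p hs h3 c hc hY hpd hd2 a
    hunit hJ j (q j) w hqw (hq j) hx'b h3L hxyz₁ hbd₁ hd2₁ a₁ hJ₁' hdd
  exact ⟨j, q j, w, hj2, hqw, hiso, hq j, hcj, h2, α, β, hα, hdvd, hmem⟩

/-- **[OURS · L1 W4.6 rung (iii-2), every `p`] THE STALLING THREAD WITH COORDINATES.** An infinite §2.1-permissible sequence inside
`Regime.mohWindowSurface` carries a branch of singular points `b` such that for every `k₀` there is a hit `k ≥ k₀` (`b_k ∈ D_k`) at which,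
for EVERY coefficient window presentation `c = (c₀, c₁, c₂)`, `J_{b_k} = (c₂^p + Σ a_i c₀^{d−i} c₁^i)`, the child `b_{k+1}` is presented
through a Rees chart `j ∈ {0, 1}` of `c` (a chart morphism over `Spec 𝒪_{Z_k,b_k}` computing the local ring) at the point of the exceptional
line over a `κ`-RATIONAL HEAVY ROOT of the centre (`(ᾱ X + β̄)^p ∣` the chart's residue polynomial, `α·(c_{j′}/c_j) + β` in the prime).
NOT a statement of the manuscript. [folklore] -/
theorem PermissibleRun.exists_stalling_thread_heavyRoot (r : PermissibleRun p K)
    (hr : ∀ k, Regime.mohWindowSurface (r.A k) (r.E k)) :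
    ∃ b : ∀ k, (r.A k).Z, (∀ k, b k ∈ (r.E k).sing) ∧ (∀ k, (r.π k).base (b (k + 1)) = b k) ∧
      ∀ k₀, ∃ k, k₀ ≤ k ∧ b k ∈ (r.D k : Set (r.A k).Z) ∧
        ∀ (c : Fin 3 → (r.A k).Z.presheaf.stalk (b k)) (_ : Ideal.span (Set.range c) = maximalIdeal _) (d : ℕ) (_ : p < d)
          (_ : d < 2 * p) (a : ℕ → (r.A k).Z.presheaf.stalk (b k)) (_ : ∃ i ≤ d, IsUnit (a i))
          (_ : stalkIdeal (r.E k).J (b k) = Ideal.span {c 2 ^ p + ∑ i ∈ Finset.range (d + 1), a i * c 0 ^ (d - i) * c 1 ^ i}),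
        ∃ (j : Fin 3) (q : Spec (.of (chartRing c j)) ⟶ (r.A (k + 1)).Z) (w : Spec (.of (chartRing c j))),
          j ≠ 2 ∧ q w = b (k + 1) ∧ IsIso (q.stalkMap w) ∧
          q ≫ r.π k = Spec.map (CommRingCat.ofHom (chartBase c j)) ≫ (r.A k).Z.fromSpecStalk (b k) ∧
          chartBase c j (c j) ∈ w.asIdeal ∧ chartGen c j 2 ∈ w.asIdeal ∧
          ∃ α β : (r.A k).Z.presheaf.stalk (b k), IsUnit α ∧
            (C (residue _ α) * X + C (residue _ β)) ^ p ∣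
              ∑ i ∈ Finset.range (d + 1), C (residue _ (a i)) *
                X ^ ((![fun i => min i d, fun i => d - i, fun _ => 0] : Fin 3 → ℕ → ℕ) j i) ∧
            chartBase c j α * chartGen c j ((![1, 0, 0] : Fin 3 → Fin 3) j) + chartBase c j β ∈ w.asIdeal := by
  classical
  obtain ⟨b, hbS, hbπ, hstall⟩ := r.exists_stalling_thread hr
  refine ⟨b, hbS, hbπ, fun k₀ => ?_⟩
  obtain ⟨k, hk, hbk, hle, -⟩ := hstall k₀
  refine ⟨k, hk, hbk, fun c hc d hpd hd2 a hunit hJ => ?_⟩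
  -- one step, stated for an arbitrary next stage `E₁ = transform` (dependent rewriting along `E_succ`)
  have key : ∀ (E₁ : IdealExponent (r.A (k + 1)).Z) (heq : E₁ = (r.E k).transform (r.π k) (r.D k))
      (h₁ : Regime.mohWindowSurface (r.A (k + 1)) E₁) (hb₁ : b (k + 1) ∈ E₁.sing)
      (hle₁ : (residualOrder (r.E k).b ((r.A k).Z.presheaf.stalk (b k)) (stalkIdeal (r.E k).J (b k))).toNat ≤
        (residualOrder E₁.b ((r.A (k + 1)).Z.presheaf.stalk (b (k + 1))) (stalkIdeal E₁.J (b (k + 1)))).toNat),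
      ∃ (j : Fin 3) (q : Spec (.of (chartRing c j)) ⟶ (r.A (k + 1)).Z) (w : Spec (.of (chartRing c j))),
        j ≠ 2 ∧ q w = b (k + 1) ∧ IsIso (q.stalkMap w) ∧
        q ≫ r.π k = Spec.map (CommRingCat.ofHom (chartBase c j)) ≫ (r.A k).Z.fromSpecStalk (b k) ∧
        chartBase c j (c j) ∈ w.asIdeal ∧ chartGen c j 2 ∈ w.asIdeal ∧
        ∃ α β : (r.A k).Z.presheaf.stalk (b k), IsUnit α ∧
          (C (residue _ α) * X + C (residue _ β)) ^ p ∣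
            ∑ i ∈ Finset.range (d + 1), C (residue _ (a i)) *
              X ^ ((![fun i => min i d, fun i => d - i, fun _ => 0] : Fin 3 → ℕ → ℕ) j i) ∧
          chartBase c j α * chartGen c j ((![1, 0, 0] : Fin 3 → Fin 3) j) + chartBase c j β ∈ w.asIdeal := by
    intro E₁ heq h₁ hb₁ hle₁
    subst heq
    exact exists_chart_heavyRoot_of_le_residualOrder (r.π k) (r.blowup k) (r.permissible k) (hr k) h₁ hb₁ (hbπ k) hbk hle₁ c hc
      hpd hd2 a hunit hJ
  exact key (r.E (k + 1)) (r.E_succ k) (hr (k + 1)) (hbS (k + 1)) hle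

end CampaignW46

end Summit.ResolutionOfSingularities.ResolutionOfSingularities.Theorems

end
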